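import Mathlib
import Summits.NavierStokesRegularity.NavierStokesRegularity.Theses.RootDecompRecordVisibility
import Summits.NavierStokesRegularity.NavierStokesRegularity.Theorems.QuarterJoltNoTerminalJoltPosition

/-!
# N27's ISOLATION CUT glue PROVED: `DiluteRecordZoom → NonIsolatedInvisibleRecordZoom → InvisibleRecordZoom`

Route `RootDecompRecordVisibility` (decomp-ns node N27), layer-2 split of the declared residual I =
`InvisibleRecordZoom` (stmt-33524) by excluded middle on «the invisible blow-up is ISOLATED-PACED»
(lens-3 g14 «THE ISOLATION CUT», critic row 166 CLEARED): I_d = `DiluteRecordZoom` (invisible but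
isolated-paced blow-ups zoom at one isolated pace-setting gradient record to a D-class ancient flow — the
attacked cell, expected theorem via the support `IsolatedPaceZoom`) and I_n = `NonIsolatedInvisibleRecordZoom`
(the declared residual: grad-ballistic or extended record structure). This file proves the generated glue item
`InvisibleRecordZoom_of_cells` (pure logic) and the exactness `I ↔ I_d ∧ I_n`, and records the S-necessity
(vacuity) of both cells. Sources: KNSS 2009 §6 (arXiv:0709.3599); Tao 2016 (arXiv:1402.0290).
-/

namespace Summit.NavierStokesRegularity.NavierStokesRegularity.Theorems.RootDecompRecordVisibilityIsolationCells

open Summit.NavierStokesRegularity.NavierStokesRegularity.Theses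

/-- The glue item `InvisibleRecordZoom_of_cells` of N27's ISOLATION CUT holds: case split on
«isolated-paced» inside the invisible cell. -/
theorem rootDecompRecordVisibility_invisibleRecordZoom_of_cells_proof :
    RootDecompRecordVisibility.InvisibleRecordZoom_of_cells := by
  intro hD hN ν T hν hT u p hcl hLH hdec hext hinv
  by_cases hiso : (∃ θ₀ M : ℝ, 0 < θ₀ ∧ ∀ R : ℝ, 0 < R → ∀ t₁ ∈ Set.Ico 0 T, ∃ t ∈ Set.Ico t₁ T, ∃ x : EuclideanSpace ℝ (Fin 3), (0 < ‖fderiv ℝ (u t) x‖ ∧ (∀ s ∈ Set.Icc 0 t, ∀ y : EuclideanSpace ℝ (Fin 3), ‖fderiv ℝ (u s) y‖ ≤ 2 * ‖fderiv ℝ (u t) x‖) ∧ (∀ s ∈ Set.Icc 0 t, ∀ y : EuclideanSpace ℝ (Fin 3), θ₀ * ‖u s y‖ ^ 2 ≤ ν * ‖fderiv ℝ (u t) x‖)) ∧ (∀ s ∈ Set.Icc 0 t, t - R / ‖fderiv ℝ (u t) x‖ ≤ s → ENNReal.ofReal (Real.sqrt (ν / ‖fderiv ℝ (u t) x‖)) *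 (∫⁻ y in Metric.ball x (R * Real.sqrt (ν / ‖fderiv ℝ (u t) x‖)), ENNReal.ofReal (Literature.Analysis.FluidPDE.frobeniusNormSq (fderiv ℝ (u s) y))) ≤ ENNReal.ofReal (M * (1 + R) ^ (0 : ℝ) * ν ^ 2)))
  · exact hD ν T hν hT u p hcl hLH hdec hext hinv hiso
  · exact hN ν T hν hT u p hcl hLH hdec hext hinv hiso

/-- EXACTNESS of the ISOLATION CUT: `I ↔ I_d ∧ I_n` (both cells are restrictions of I). -/
theorem rootDecompRecordVisibility_invisibleRecordZoom_iff_cells :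
    RootDecompRecordVisibility.InvisibleRecordZoom ↔
      RootDecompRecordVisibility.DiluteRecordZoom ∧ RootDecompRecordVisibility.NonIsolatedInvisibleRecordZoom :=
  ⟨fun hI => ⟨fun ν T hν hT u p hcl hLH hdec hext hinv _ => hI ν T hν hT u p hcl hLH hdec hext hinv,
      fun ν T hν hT u p hcl hLH hdec hext hinv _ => hI ν T hν hT u p hcl hLH hdec hext hinv⟩,
    fun h => rootDecompRecordVisibility_invisibleRecordZoom_of_cells_proof h.1 h.2⟩

/-- S-NECESSITY (vacuity): under Clay (A) there is no frame blow-up, so both cells hold. -/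
theorem rootDecompRecordVisibility_cells_of_navierStokesRegularity (hA : NavierStokesRegularity) :
    RootDecompRecordVisibility.DiluteRecordZoom ∧ RootDecompRecordVisibility.NonIsolatedInvisibleRecordZoom := by
  have h := Theorems.NoTerminalJolt.noBlowup_of_navierStokesRegularity hA
  exact ⟨fun ν T hν hT u p hcl hLH hdec hext _ _ => absurd (h ν T hν hT u p hcl hLH hdec) hext,
    fun ν T hν hT u p hcl hLH hdec hext _ _ => absurd (h ν T hν hT u p hcl hLH hdec) hext⟩

/-- N27's deciding theorem re-entered through the cells: X2 → V → I_d → I_n → Clay (A). -/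
theorem rootDecompRecordVisibility_closes_via_cells (hX2 : RootDecompRecordVisibility.GaldiGateEngine)
    (hV : RootDecompRecordVisibility.VisibleRecordZoom) (hD : RootDecompRecordVisibility.DiluteRecordZoom)
    (hN : RootDecompRecordVisibility.NonIsolatedInvisibleRecordZoom) : NavierStokesRegularity :=
  RootDecompRecordVisibility.closes hX2 hV (rootDecompRecordVisibility_invisibleRecordZoom_of_cells_proof hD hN)

end Summit.NavierStokesRegularity.NavierStokesRegularity.Theorems.RootDecompRecordVisibilityIsolationCells
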